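import Mathlib
import HarnessLib
import Literature.MathematicalPhysics.StatisticalMechanics.FlowStepIntegrability
import Literature.MathematicalPhysics.StatisticalMechanics.RenormalisationStepDisjoint
import Literature.MathematicalPhysics.StatisticalMechanics.PolymerProductLipschitzABKM
import Literature.MathematicalPhysics.StatisticalMechanics.WeightFieldNormABKM
import Literature.MathematicalPhysics.StatisticalMechanics.RGStepABKM

/-!
# One renormalisation step along the flow for the torus data: Proposition 6.6 with its Fubini
# hypothesis discharged, factorisation of `K_{k+1}`, and the weight bound `|F_k| ≤ C_k w_k^Λ`
# ([ABKM19] Proposition 6.6, Lemma 6.4 (5), Lemma 8.3, (4.11))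

For the concrete torus data of [ABKM19] (`abkmStepData L R k 𝒞s`, norms `abkmNormParams`, weights
`abkmWeightData`) and a step kernel `𝒞s (k+1)` with `StepKernelBounds`, this file provides the three
facts about a single step `k → k+1` that the iterated representation (4.11)–(4.12) of the partition
function consumes along a trajectory `(H_k, K_k)` in the domain of the maps:

* **`factorises_nextKStep_abkm`** — Lemma 6.4 (5) for the torus data: `K_{k+1} = S(H_k,K_k)` factors on
  scale `k+1` (the radii bookkeeping `2·starRad_{k+1} + 2p + ⌈L^{k+1}/2⌉ ≤ L^{k+1} + 1` from
  `L ≥ 2^{d+3} + 16R`, `4p ≤ 2^{d+2}`, and the signed finite range (iii) of the kernel);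
* **`norm_pcirc_expNegH_mul_le_weight_abkm`** — `|(e^{−H} ∘_k K)(Λ, ψ)| ≤ C · w_k^Λ(ψ)` for `(H,K)` in
  the domain (Lemma 8.3 / Lemma 9.3 / (w5) via `tayNormLE_bprod_expNegH_mul_abkm`), together with the
  gauge-locality and the continuity of the integrand;
* **`integral_pcirc_step_abkm`** — Proposition 6.6:
  `∫ (e^{−H} ∘_k K)(Λ, φ+ξ) μ_{k+1}(dξ) = (S(H,K) ∘_{k+1} e^{−H_{k+1}})(Λ, φ)`, `H_{k+1} = nextH`.

Everything is proved; no named fact.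

## References
* S. Adams, S. Buchholz, R. Kotecký, S. Müller, arXiv:1910.13564, Proposition 6.6, Lemma 6.4 (5),
  Lemma 8.3, Ch. 4.2 (4.11) [AdamsBuchholzKoteckyMuller2019].
-/

noncomputable section

namespace Literature.MathematicalPhysics.StatisticalMechanics.GradientRG

open scoped BigOperators Classical
open Finset Matrix MeasureTheory
open Literature.MathematicalPhysics.StatisticalMechanics.TorusPolymer
  (IsPolymer Separated blocks polys bprod pcirc blockOf thicken mem_polys mem_blocks isPolymer_blockOf
    isPolymer_empty isPolymer_univ)
open Literature.Barriers.CriticalPhenomena.LongRangePhi4.Polymer (IsConn components)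
open Literature.MathematicalPhysics.QuantumFieldTheory

variable {d M : ℕ} [NeZero M]

/-! ## Lemma 6.4 (5) for the torus data -/

/-- **`K_{k+1} = S(H_k, K_k)` factors on scale `k+1`** for the torus data (`L` odd, `L ≥ 2^{d+3}+16R`,
`4p ≤ 2^{d+2}`, `k + 1 ≤ N`), a step kernel with zero sum, even, positive on mean-zero fields and
constant `m ≤ 0` beyond `|x|_∞ ≥ L^{k+1}/2`, and an activity `K` factorising on scale `k` with
`K(∅) = 1`, measurable and local on connected polymers. [cite: AdamsBuchholzKoteckyMuller2019, Lemma 6.4 (5)] -/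
theorem factorises_nextKStep_abkm {L N Mord R p r₀ : ℕ} {h θbar A δ₀ δ₁ : ℝ}
    {𝒞 𝒞s : ℕ → (Fin d → ZMod M) → ℝ} (hLodd : Odd L) (hL : 2 ^ (d + 3) + 16 * R ≤ L)
    (hM : M = L ^ N) {k : ℕ} (hkN : k + 1 ≤ N) (hp : d / 2 + 1 ≤ p) (hp4 : 4 * p ≤ 2 ^ (d + 2)) (hh : 0 < h)
    (h0 : ∑ x, 𝒞s (k + 1) x = 0) (heven : ∀ x, 𝒞s (k + 1) (-x) = 𝒞s (k + 1) x)
    (hpos : ∀ φ : (Fin d → ZMod M) → ℝ, ∑ x, φ x = 0 → 0 ≤ ∑ x, ∑ y, φ x * 𝒞s (k + 1) (x - y) * φ y)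
    {m : ℝ} (hm : m ≤ 0)
    (hrange : ∀ x : Fin d → ZMod M, ((L : ℝ) ^ (k + 1)) / 2 ≤ (GradientFRD.supNorm x : ℝ) → 𝒞s (k + 1) x = m)
    (H : RelevantHamiltonian ℂ d) {K : Finset (Fin d → ZMod M) → ((Fin d → ZMod M) → ℝ) → ℂ}
    (hKfac : Factorises (L ^ k) K) (hK0 : ∀ φ, K ∅ φ = 1) (hKmeas : ∀ Y, Measurable (K Y))
    (hKloc : ∀ Y, IsPolymer (L ^ k) Y → IsConn Y →
      IsGaugeLocal ((abkmNormParams L N Mord R p r₀ h θbar A (schedDelta δ₀ δ₁ N) 𝒞).gauge k Y) (K Y)) :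
    Factorises (L ^ (k + 1)) (nextKStep (abkmStepData L R k 𝒞s) H K) := by
  set D := abkmStepData L R k 𝒞s with hDdef
  have hDs : D.s = L ^ k := rfl
  have hDL : D.L = L := rfl
  have hD𝒞 : D.𝒞 = 𝒞s (k + 1) := rfl
  have h8 : 8 ≤ 2 ^ (d + 3) := by
    calc 8 = 2 ^ 3 := by norm_num
      _ ≤ 2 ^ (d + 3) := Nat.pow_le_pow_right (by norm_num) (by omega)
  have hL4 : 4 ≤ L := by omega
  have hL0 : (0 : ℝ) < L := by exact_mod_cast hLodd.pos
  have h2dR : 2 ^ d + R ≤ L := by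
    have : 2 ^ d ≤ 2 ^ (d + 3) := Nat.pow_le_pow_right (by norm_num) (by omega)
    omega
  have hMo : Odd M := by rw [hM]; exact hLodd.pow
  have hsodd : Odd (L ^ k) := hLodd.pow
  obtain ⟨t, ht⟩ : ∃ t, N = k + t := ⟨N - k, by omega⟩
  have hMt : M = L ^ k * L ^ t := by rw [← pow_add, ← ht]; exact hM
  have htodd : Odd (L ^ t) := hLodd.pow
  have h𝔥k : 0 < fieldWt h (L : ℝ) d k := fieldWt_pos hh hL0 d k
  -- locality of `K` on all `k`-polymers
  have hKall : ∀ Y, IsPolymer D.s Y →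
      IsGaugeLocal (fieldGauge (fieldWt h (L : ℝ) d k) ((L : ℝ) ^ k) p (thicken (starRad R L d k) Y)) (K Y) := by
    intro Y hY
    have hKloc' : ∀ Y, IsPolymer (L ^ k) Y → IsConn Y →
        IsGaugeLocal (fieldGauge (fieldWt h (L : ℝ) d k) ((L : ℝ) ^ k) p (thicken (starRad R L d k) Y)) (K Y) :=
      fun Y hY hc => by rw [← abkmNormParams_gauge L N Mord R p r₀ h θbar A (schedDelta δ₀ δ₁ N) 𝒞 k Y]; exact hKloc Y hY hc
    exact isGaugeLocal_of_factorises_polys hMt hsodd htodd hKfac hK0 hKloc' hY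
  -- the radii
  have hprod : D.L * D.s = L ^ (k + 1) := (pow_succ' L k).symm
  have hodd1 : Odd (L ^ (k + 1)) := hLodd.pow
  obtain ⟨ρ', hρ'⟩ : ∃ ρ' : ℕ, L ^ (k + 1) + 1 = 2 * ρ' := by
    obtain ⟨j, hj⟩ := hodd1; exact ⟨j + 1, by omega⟩
  have hrr : starRad R L d k ≤ starRad R L d (k + 1) := starRad_le_succ h2dR k
  have hr : starRad R L d k + (2 ^ d - 1) * D.s ≤ starRad R L d (k + 1) := by
    rw [hDs]; exact starRad_add_le_succ h2dR k
  have h82 : 2 ^ (d + 2) = 4 * 2 ^ d := by rw [pow_add]; norm_num; ring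
  have h83 : 2 ^ (d + 3) = 8 * 2 ^ d := by rw [pow_add]; norm_num; ring
  have hp1 : 1 ≤ p := by omega
  -- key: `4·starRad_{k+1} + 4p ≤ L^{k+1}`
  have hkey : 4 * starRad R L d (k + 1) + 4 * p ≤ L ^ (k + 1) := by
    cases k with
    | zero =>
      rw [zero_add, starRad_one, pow_one]
      omega
    | succ j =>
      rw [starRad_add_two, pow_succ L (j + 1)]
      have hb1 : 1 ≤ L ^ (j + 1) := Nat.one_le_pow _ _ (by omega)
      have h8a : 8 * 2 ^ d ≤ L := by omega
      calc 4 * (2 ^ d * L ^ (j + 1)) + 4 * p ≤ 4 * (2 ^ d * L ^ (j + 1)) + 2 ^ (d + 2) * L ^ (j + 1) := by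
            nlinarith [hp4, hb1, Nat.zero_le (2 ^ (d + 2))]
        _ = (8 * 2 ^ d) * L ^ (j + 1) := by rw [h82]; ring
        _ ≤ L * L ^ (j + 1) := Nat.mul_le_mul_right _ h8a
        _ = L ^ (j + 1) * L := by ring
  have hx4 : 4 * L ^ k ≤ L ^ (k + 1) := by
    rw [pow_succ, mul_comm]; exact Nat.mul_le_mul_left _ hL4
  have hDcond : 2 * starRad R L d (k + 1) + 2 ≤ D.L * D.s + 1 := by rw [hprod]; omega
  have hDscond : 2 * starRad R L d (k + 1) + (D.s + 1) ≤ D.L * D.s + 1 := by rw [hprod, hDs]; omega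
  have hDρcond : 2 * starRad R L d (k + 1) + 2 * p + ρ' ≤ D.L * D.s + 1 := by rw [hprod]; omega
  -- the finite range in the form `ρ' ≤ |x|_∞`
  have hrange' : ∀ x : Fin d → ZMod M, ρ' ≤ GradientFRD.supNorm x → D.𝒞 x = m := by
    intro x hx
    rw [hD𝒞]
    refine hrange x ?_
    have h1 : ((L : ℝ) ^ (k + 1)) / 2 ≤ (ρ' : ℝ) := by
      have : ((L ^ (k + 1) + 1 : ℕ) : ℝ) = 2 * (ρ' : ℝ) := by exact_mod_cast hρ'
      push_cast at this
      linarith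
    exact h1.trans (by exact_mod_cast hx)
  have hfac := factorises_nextKStep D (t := L ^ t) (p := p) (r := starRad R L d k) (r' := starRad R L d (k + 1))
    (ρ := ρ') h𝔥k.ne' (pow_pos hL0 k).ne' (by rw [hDs]; exact hMt) (by rw [hDs]; exact hsodd) htodd
    (by rw [hDL]; exact hLodd) hrr hr hDcond hDscond hDρcond hp (by rw [hD𝒞]; exact h0)
    (by rw [hD𝒞]; exact heven) (by rw [hD𝒞]; exact hpos) hm hrange' H hKall hKmeas (by rw [hDs]; exact hKfac)
  rw [hprod] at hfac
  exact hfac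

/-! ## The flow integrand `(e^{−H} ∘_k K)(Λ)`: gauge locality, continuity, weight bound -/

section Integrand

variable {L N Mord R n p r₀ : ℕ} {θbar lam μ δ₁ δ₀ A𝒫 h A : ℝ} {𝒞 : ℕ → (Fin d → ZMod M) → ℝ}

/-- `(e^{−H})^{Z} K(Y)` is local for the gauge `T_k^{(Z∪Y)*}` (`Z, Y` `k`-polymers, `K` factorising
with `K(∅)=1` and local on connected polymers). [cite: AdamsBuchholzKoteckyMuller2019, Lemma 8.3] -/
theorem isGaugeLocal_bprod_expNegH_mul_abkm (hLodd : Odd L) (hM : M = L ^ N) {k : ℕ} (hkN : k ≤ N)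
    (hp : d / 2 + 1 ≤ p) (hh : 0 < h)
    {Z Y : Finset (Fin d → ZMod M)} (hZ : IsPolymer (L ^ k) Z) (hY : IsPolymer (L ^ k) Y)
    (H : RelevantHamiltonian ℂ d) {K : Finset (Fin d → ZMod M) → ((Fin d → ZMod M) → ℝ) → ℂ}
    (hKfac : Factorises (L ^ k) K) (hK0 : ∀ φ, K ∅ φ = 1)
    (hKloc : ∀ Y, IsPolymer (L ^ k) Y → IsConn Y →
      IsGaugeLocal ((abkmNormParams L N Mord R p r₀ h θbar A (schedDelta δ₀ δ₁ N) 𝒞).gauge k Y) (K Y)) :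
    IsGaugeLocal ((abkmNormParams L N Mord R p r₀ h θbar A (schedDelta δ₀ δ₁ N) 𝒞).gauge k (Z ∪ Y))
      (fun ψ => bprod (L ^ k) (fun B => expNegH H B ψ) Z * K Y ψ) := by
  set P := abkmNormParams L N Mord R p r₀ h θbar A (schedDelta δ₀ δ₁ N) 𝒞 with hP
  have hL0 : (0 : ℝ) < L := by exact_mod_cast hLodd.pos
  have h𝔥 : 0 < P.𝔥 k := fieldWt_pos hh hL0 d k
  have hR : 0 < P.R k := by show (0 : ℝ) < (L : ℝ) ^ k; positivity
  have hZX : Z ⊆ Z ∪ Y := Finset.subset_union_left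
  have hYX : Y ⊆ Z ∪ Y := Finset.subset_union_right
  have hMo : Odd M := by rw [hM]; exact hLodd.pow
  obtain ⟨t, ht⟩ : ∃ t, N = k + t := ⟨N - k, by omega⟩
  have hMt : M = L ^ k * L ^ t := by rw [← pow_add, ← ht]; exact hM
  refine IsGaugeLocal.mul ?_ ?_
  · unfold TorusPolymer.bprod
    refine IsGaugeLocal.prod _ fun B hB => ?_
    have hBX : B ⊆ Z ∪ Y := (hZ.subset_of_mem_blocks hB).trans hZX
    exact (isGaugeLocal_cexp_neg_eval h𝔥.ne' hR.ne' hp (TorusPolymer.subset_thicken _ _) H).of_norm_le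
      fun ξ => norm_fieldGauge_mono_set _ _ _ (TorusPolymer.thicken_mono _ hBX) ξ
  · have hloc := isGaugeLocal_of_factorises_polys (𝔥 := fieldWt h (L : ℝ) d k) (Rg := (L : ℝ) ^ k) (p := p)
      (rad := starRad R L d k) hMt hLodd.pow hLodd.pow hKfac hK0
      (fun Y hY hc => by rw [← abkmNormParams_gauge L N Mord R p r₀ h θbar A (schedDelta δ₀ δ₁ N) 𝒞 k Y]; exact hKloc Y hY hc) hY
    rw [← abkmNormParams_gauge L N Mord R p r₀ h θbar A (schedDelta δ₀ δ₁ N) 𝒞 k Y] at hloc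
    exact hloc.of_norm_le fun ξ => norm_fieldGauge_mono_set _ _ _ (TorusPolymer.thicken_mono _ hYX) ξ

/-- The flow integrand `(e^{−H} ∘_k K)(Λ, ψ)` is continuous in the field (for `K(Y, ·)` continuous).
[cite: AdamsBuchholzKoteckyMuller2019, Ch. 4.2 (4.11)] -/
theorem continuous_pcirc_expNegH (s : ℕ) (H : RelevantHamiltonian ℂ d)
    {K : Finset (Fin d → ZMod M) → ((Fin d → ZMod M) → ℝ) → ℂ} (hK : ∀ Y, Continuous (K Y)) :
    Continuous fun ψ : (Fin d → ZMod M) → ℝ => pcirc s (fun V => expNegH H V ψ) (fun U => K U ψ) univ := by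
  unfold TorusPolymer.pcirc
  refine continuous_finsetSum _ fun Y _ => Continuous.mul ?_ (hK _)
  unfold expNegH
  exact Complex.continuous_exp.comp (contDiff_eval H Y (n := 0)).continuous.neg

/-- **`|(e^{−H} ∘_k K)(Λ, ψ)| ≤ C · w_k^Λ(ψ)`** for `(H, K)` in the domain of the renormalisation maps
(torus data; `‖H‖_{k,0} ≤ ⅛`, `K` factorising, `K(∅) = 1`, `C^{r₀}`, local, `‖K‖_k^{(A)} ≤ C`), with the
explicit constant `Σ_{Y∈𝓟_k(Λ)} (e^{1/4})^{|𝓑_k(Y)|} ∏_{Y'∈𝒞(Λ∖Y)} C A^{−|Y'|_k}`.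
[cite: AdamsBuchholzKoteckyMuller2019, Lemma 8.3 / (8.2)] -/
theorem norm_pcirc_expNegH_mul_le_weight_abkm (hd : 2 ≤ d) (hLodd : Odd L)
    (hM : M = L ^ N) {k : ℕ} (hkN : k ≤ N) (hp : d / 2 + 1 ≤ p) (hMord : d / 2 + 1 ≤ Mord)
    (hB : AbkmWeightBounds L N Mord R n θbar lam μ δ₁ δ₀ A𝒫 𝒞
      (abkmWeightData L N Mord R θbar (schedDelta δ₀ δ₁ N) 𝒞))
    (hδ₀ : 0 < δ₀) (hδ₁ : 0 < δ₁) (hh : 0 < h) (hh0 : hZeroSq d R δ₀ δ₁ ≤ h ^ 2) (hA : 0 < A)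
    {H : RelevantHamiltonian ℂ d}
    (hH : hamNorm (fieldWt h (L : ℝ) d k) ((L : ℝ) ^ k) (L ^ (d * k)) H ≤ 1 / 8)
    {K : Finset (Fin d → ZMod M) → ((Fin d → ZMod M) → ℝ) → ℂ} {C : ℝ} (hC : 0 ≤ C)
    (hK : WeakNormLE (abkmNormParams L N Mord R p r₀ h θbar A (schedDelta δ₀ δ₁ N) 𝒞) k K C)
    (hKfac : Factorises (L ^ k) K) (hK0 : ∀ φ, K ∅ φ = 1) (hKd : ∀ Y, ContDiff ℝ r₀ (K Y))
    (hKloc : ∀ Y, IsPolymer (L ^ k) Y → IsConn Y →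
      IsGaugeLocal ((abkmNormParams L N Mord R p r₀ h θbar A (schedDelta δ₀ δ₁ N) 𝒞).gauge k Y) (K Y))
    (ψ : (Fin d → ZMod M) → ℝ) :
    ‖pcirc (L ^ k) (fun V => expNegH H V ψ) (fun U => K U ψ) univ‖ ≤
      (∑ Y ∈ polys (L ^ k) univ, (∏ _B ∈ blocks (L ^ k) Y, Real.exp (1 / 4)) *
        ∏ Y' ∈ components (univ \ Y), C * (abkmNormParams L N Mord R p r₀ h θbar A (schedDelta δ₀ δ₁ N) 𝒞).aFactor k Y') *
        (abkmWeightData L N Mord R θbar (schedDelta δ₀ δ₁ N) 𝒞).weight k univ ψ := by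
  set P := abkmNormParams L N Mord R p r₀ h θbar A (schedDelta δ₀ δ₁ N) 𝒞 with hP
  set W := abkmWeightData L N Mord R θbar (schedDelta δ₀ δ₁ N) 𝒞 with hW
  have hΛ : IsPolymer (L ^ k) (univ : Finset (Fin d → ZMod M)) := isPolymer_univ _
  unfold TorusPolymer.pcirc
  rw [Finset.sum_mul]
  refine (norm_sum_le _ _).trans (Finset.sum_le_sum fun Y hY => ?_)
  obtain ⟨-, hYp⟩ := mem_polys.1 hY
  have hYc : IsPolymer (L ^ k) (univ \ Y) := hΛ.sdiff hYp
  have hdisj : Disjoint Y (univ \ Y) := Finset.disjoint_sdiff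
  have hXu : Y ∪ (univ \ Y) = univ := Finset.union_sdiff_of_subset (Finset.subset_univ Y)
  have hb := tayNormLE_bprod_expNegH_mul_abkm (p := p) (r₀ := r₀) hd hLodd hM hkN hp hMord hB hδ₀ hδ₁ hh hh0 hA
    hYp hYc hdisj hH hC hK hKfac hK0 hKd hKloc
  have hloc := isGaugeLocal_bprod_expNegH_mul_abkm (Mord := Mord) (r₀ := r₀) (θbar := θbar) (A := A)
    (δ₀ := δ₀) (δ₁ := δ₁) (𝒞 := 𝒞) hLodd hM hkN hp hh hYp hYc H hKfac hK0 hKloc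
  rw [hXu] at hb hloc
  have h1 := norm_apply_le_tayNorm r₀ hloc ψ
  have h2 := hb ψ
  have heq : expNegH H Y ψ * K (univ \ Y) ψ = bprod (L ^ k) (fun B => expNegH H B ψ) Y * K (univ \ Y) ψ := by
    rw [show bprod (L ^ k) (fun B => expNegH H B ψ) Y = expNegH H Y ψ from bprod_cexp_neg_eval H hYp ψ]
  rw [heq]
  exact h1.trans h2

end Integrand

/-! ## Proposition 6.6 along the flow -/

/-- **Proposition 6.6 for the torus data, Fubini hypothesis discharged**: for `k ≤ N`, a step kernel
`𝒞s (k+1)` with `StepKernelBounds`, `‖H‖_{k,0} ≤ ⅛` and an admissible factorising `K`: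
`∫ (e^{−H} ∘_k K)(Λ, φ+ξ) μ_{k+1}(dξ) = (S(H,K) ∘_{k+1} e^{−H_{k+1}})(Λ, φ)` with `S = nextKStep`,
`H_{k+1} = nextH` for the step data `abkmStepData L R k 𝒞s`.
[cite: AdamsBuchholzKoteckyMuller2019, Proposition 6.6] -/
theorem integral_pcirc_step_abkm {L N Mord R n p r₀ : ℕ}
    {θbar lam μ δ₁ δ₀ A𝒫 A𝒫' C₂ h A : ℝ} {𝒞 𝒞s : ℕ → (Fin d → ZMod M) → ℝ}
    (hd : 2 ≤ d) (hLodd : Odd L) (hM : M = L ^ N) {k : ℕ} (hkN : k ≤ N) (hp : d / 2 + 1 ≤ p)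
    (hMord : d / 2 + 1 ≤ Mord)
    (hB : AbkmWeightBounds L N Mord R n θbar lam μ δ₁ δ₀ A𝒫 𝒞
      (abkmWeightData L N Mord R θbar (schedDelta δ₀ δ₁ N) 𝒞))
    (hS : StepKernelBounds (abkmWeightData L N Mord R θbar (schedDelta δ₀ δ₁ N) 𝒞) L k A𝒫' C₂ (𝒞s (k + 1)))
    (hδ₀ : 0 < δ₀) (hδ₁ : 0 < δ₁) (hh : 0 < h) (hh0 : hZeroSq d R δ₀ δ₁ ≤ h ^ 2) (hA : 0 < A)
    {H : RelevantHamiltonian ℂ d}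
    (hH : hamNorm (fieldWt h (L : ℝ) d k) ((L : ℝ) ^ k) (L ^ (d * k)) H ≤ 1 / 8)
    {K : Finset (Fin d → ZMod M) → ((Fin d → ZMod M) → ℝ) → ℂ} {C : ℝ} (hC : 0 ≤ C)
    (hK : WeakNormLE (abkmNormParams L N Mord R p r₀ h θbar A (schedDelta δ₀ δ₁ N) 𝒞) k K C)
    (hKfac : Factorises (L ^ k) K) (hK0 : ∀ φ, K ∅ φ = 1) (hKd : ∀ Y, ContDiff ℝ r₀ (K Y))
    (hKloc : ∀ Y, IsPolymer (L ^ k) Y → IsConn Y →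
      IsGaugeLocal ((abkmNormParams L N Mord R p r₀ h θbar A (schedDelta δ₀ δ₁ N) 𝒞).gauge k Y) (K Y))
    (φ : (Fin d → ZMod M) → ℝ) :
    ∫ ξ, pcirc (L ^ k) (fun Z => expNegH H Z (φ + ξ)) (fun Y => K Y (φ + ξ)) univ ∂(stepMeasure (𝒞s (k + 1)))
      = pcirc (L ^ (k + 1)) (fun U => nextKStep (abkmStepData L R k 𝒞s) H K U φ)
          (fun V => expNegH (nextH (abkmStepData L R k 𝒞s) H K) V φ) univ := by
  have h := rgStep_identity_of_disjoint (abkmStepData L R k 𝒞s) hLodd.pow hLodd H (K := K) (φ := φ)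
    (fun Z Y hZ hY hZY => integrable_expNegH_mul_of_stepKernelBounds (p := p) (r₀ := r₀) hd hLodd hM hkN hp hMord
      hB hS hδ₀ hδ₁ hh hh0 hA hH hC hK hKfac hK0 hKd hKloc hZ hY hZY φ)
  rw [show (abkmStepData L R k 𝒞s).L * (abkmStepData L R k 𝒞s).s = L ^ (k + 1) from (pow_succ' L k).symm] at h
  exact h

end Literature.MathematicalPhysics.StatisticalMechanics.GradientRG

end
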